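import Summits.BirchSwinnertonDyer.BirchSwinnertonDyer.Theorems.PrintCf2SplitBadTwoKummerOutsideLevelLift
import Summits.BirchSwinnertonDyer.BirchSwinnertonDyer.Theorems.CongruentShaFreeCutSelmerRelaxationUniform
import HarnessLib

/-!
# Crux `PrintCf2.SplitBadTwoRankOneOfFacts` (stmt-BirchSwinnertonDyer-20368), road α v10.4/10.5, (BF) «`Ш` finite ⟹ `𝔖_{v̄}(K, W*)` finite»,
# part 1: the LEVEL LIFT of `𝔖` into `kummerOutside`, and a UNIFORM RELAXATION EXPONENT at one place over any number field

Cell `bsd-print-cf2`, EXTRA WIDTH seat `bsd-line-cf2-p1-w4` g10 (prover-bsd-line-cf2-p1-w4-g10-0); `--supports stmt-BirchSwinnertonDyer-20368`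
(helper, Theses-free). HONEST FRAMING: nothing here closes the crux or a registered stub; BSD is not proved by any of this; no summit
statement is proved by this seat. No definition, no named fact, no `sorry`. LEAD ASSIGN 2026-08-29T00:16:10Z (1): (BF)
`finite_restrictedSelmerBase_of_finite_sha_of_frame`. This file carries the two generic, `Finite 𝔖`-FREE inputs of the first factor
`[𝔖 : 𝔖 ⊓ j_*⁻¹ Sel_{p^∞}]` of the finiteness proof (STATUS 2026-08-29 FINDING of this seat).

WHAT (generic `V/K` elliptic over a number field, prime `p`):
* §1 `exists_mem_kummerOutside_levelLift_eq` (`K` totally complex, `v ≠ v̄` the places above `p`): every class `y ∈ 𝔖_{v̄}(K, W*)` with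
  `p^k y = 0` is the level lift `Φ_k(x) = res_⊤ e_* ι_{k,*} x` of a class `x ∈ kummerOutside V (p^k) {v}` — -w5 g3's
  `exists_levelLift_eq_of_mem_restrictedSelmerBase` (p677230) for the torsion-strict structure, plus «torsion classes are Kummer classes»
  (X11b `LevelKummer.ker_map_primaryInclusion_le_kummerLocalConditionAt`) and `H¹(ℂ, ·) = 0`; this is the `⊇` half of -w8 g3's
  `map_resOfLe_levelLift_kummerOutside_eq_range` (p679115) WITHOUT its hypothesis «`p^k` kills `𝔖`» (which is `Finite 𝔖` in disguise).
* §2 `exists_addMonoidHom_padicInt_eq_zero_iff` (pure algebra): an abelian group with a finite-index subgroup `U ≃+ ℤ_p` carries an additive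
  `λ : G → ℤ_p` vanishing exactly on the torsion (`x ↦ e([G:U]·x)`).
* §3 `exists_relIndex_selmerGroup_kummerOutside_mul_pow_le_of_apply_ne_zero`: bsd-cn100's rank-one bound
  `CongruentShaFreeCutSelmerRelaxationUniform.exists_relIndex_selmerGroup_kummerOutside_mul_pow_le` with its hypothesis `rank_ℤ V(K) = 1`
  replaced by what its proof uses — ONE point `P₁ ∈ V(K)` and an additive `λ : V(K_{v₀}) → ℤ_p` with `λ(P₁) ≠ 0`:
  `[H¹_{𝓛,⊤ at v₀}(K, V[p^{k+1}]) : Sel^{(p^{k+1})}] · p^{k+1−v} ≤ #V(K_{v₀})[p^{k+1}] · #(𝓞_{v₀}/p^{k+1})` for ONE `v` and every `k`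
  (Tate–Poitou reciprocity at finite level, tree theorems `poitouTate_sum_localTatePairing_eq_zero_holds` + local Euler characteristic, via
  `relIndex_selmerGroup_kummerOutside_mul_addOrderOf_le`).
* §4 **`exists_uniform_nsmul_mem_selmerGroup_of_apply_ne_zero`**: if moreover `#(𝓞_{v₀}/p^{k+1}) = p^{k+1}` for all `k` (a place of degree one),
  there is ONE `N ≠ 0` with `N • H¹_{𝓛, ⊤ at v₀}(K, V[p^{k+1}]) ⊆ Sel^{(p^{k+1})}(V/K)` for every `k` (`#V(K_{v₀})[n] ≤ [V(K_{v₀}) : U]` for a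
  torsion-free finite-index `U`, Silverman VII.6.3) — the `K`-level twin of bsd-cn100's `exists_uniform_nsmul_mem_selmerGroup_of_mem_kummerOutside`.
presearch: Jetchev–Skinner–Wan 2017 Prop. 3.2.1 (duality half), Milne ADT I 4.10(b)/2.8/3.3, Silverman AEC VII.6.3, X.4 → tree theorems (bsd-cn100
`CongruentShaFreeCut…`, X11b, -w5 and -w8 of this cell); no new fact. beyond-print theorem: no.

References: [JetchevSkinnerWan2017] Prop. 3.2.1; [MilneADT2006] I Cor. 2.3, Thm. 2.8, Lemma 3.3, Thm. 4.10(b); [SilvermanAEC2009] Prop. VII.6.3,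
VIII.§2, X.§4; [GreenbergLNM1716] §5 proof of Prop. 5.8; [Agboola2007] §3, §6.
-/

noncomputable section

open scoped Classical

set_option linter.dupNamespace false
set_option autoImplicit false

open CategoryTheory Function Field NumberField IsDedekindDomain WeierstrassCurve
open Literature.NumberTheory.EllipticCurves Literature.NumberTheory.EllipticCurves.GreenbergSelmer
open Literature.NumberTheory.EllipticCurves.Agboola2007
open Literature.NumberTheory.GaloisRepresentations
open Literature.NumberTheory.GaloisRepresentations.DiscreteGaloisModule (SelmerStructure)
open Literature.NumberTheory.GaloisCohomology
open scoped ContRepresentation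
open Summit.BirchSwinnertonDyer.Rank1Residual.X11b
open Summit.BirchSwinnertonDyer.Rank1Residual.X11b.LocBridge
open Summit.BirchSwinnertonDyer.Rank1Residual.X11b.Levels
open Summit.BirchSwinnertonDyer.BirchSwinnertonDyer.Theorems.PrintCf2.RestrictedSelmerPair
open Summit.BirchSwinnertonDyer.BirchSwinnertonDyer.Theorems.CongruentShaFreeCutSelmerRelaxationUniform

namespace Summit.BirchSwinnertonDyer.BirchSwinnertonDyer.Theorems.PrintCf2.RelaxationLift

/-! ## §1. Every `p^k`-torsion class of `𝔖_{v̄}(K, W*)` is the level lift of a class of `kummerOutside V (p^k) {v}` -/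

section Lift

variable {K : Type} [Field K] [NumberField K] (V : WeierstrassCurve K) [V.IsElliptic] (p : ℕ) [Fact p.Prime]
  (π : V.endRing) (r : ℤ_[p]) (k : ℕ)
  (e : V.geomPrimaryTorsion p →+ ↥(V.endEigenPrimaryTorsion p π r))
  (he : ∀ (σ : absoluteGaloisGroup K) (m : V.geomPrimaryTorsion p), e (σ • m) = σ • e m)

/-- **LEVEL LIFT OF `𝔖` INTO `kummerOutside`** (`K` totally complex, `v ≠ v̄` the places above `p`): a class `y ∈ 𝔖_{v̄}(K, W*)` killed by
`p^k` is `Φ_k(x) = res_⊤ e_* ι_{k,*} x` for some `x ∈ H¹(K, E[p^k])` satisfying the Kummer condition at every place `≠ v` — -w5 g3's lift for the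
torsion-strict structure (`exists_levelLift_eq_of_mem_restrictedSelmerBase`), torsion classes being Kummer classes
(`LevelKummer.ker_map_primaryInclusion_le_kummerLocalConditionAt`) and the complex places carrying no condition (`LocBridge.eq_top_of_isComplex`).
NO hypothesis «`p^k` kills `𝔖`». [cite: GreenbergLNM1716, §5 proof of Prop. 5.8] [cite: Agboola2007, §3 (arXiv p0008)] -/
theorem exists_mem_kummerOutside_levelLift_eq [IsTotallyComplex K] [NeZero (p ^ k)]
    (he₁ : ∀ x : ↥(V.endEigenPrimaryTorsion p π r), e x = x)
    {v vbar : HeightOneSpectrum (𝓞 K)} (hall : ∀ w : HeightOneSpectrum (𝓞 K), ((p : ℕ) : 𝓞 K) ∈ w.asIdeal → w = v ∨ w = vbar)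
    {y : subgroupH1 (⊤ : Subgroup (absoluteGaloisGroup K)) ↥(V.endEigenPrimaryTorsion p π r)}
    (hy : y ∈ restrictedSelmerBase ↥(V.endEigenPrimaryTorsion p π r) p vbar) (hNy : p ^ k • y = 0) :
    ∃ x ∈ kummerOutside V (p ^ k) {Sum.inr v},
      resH1Hom (Literature.NumberTheory.EllipticCurves.subgroupIncl (⊤ : Subgroup (absoluteGaloisGroup K)))
          (AddMonoidHom.id ↥(V.endEigenPrimaryTorsion p π r)) (fun _ _ ↦ rfl)
          (resH1Hom (ContinuousMonoidHom.id (absoluteGaloisGroup K)) e (fun σ m ↦ he σ m)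
            (toDiscreteH1 (isOpen_stabilizer_geomPrimaryTorsion V p) (galoisCohomology.map (primaryInclusion V p k) 1 x))) = y := by
  -- the torsion-strict structure at level `k`
  let 𝓕k : SelmerStructure (V.torsionGaloisModule ((p ^ k : ℕ) : ℤ)) := fun pl ↦
    match pl with
    | Sum.inl _ => ⊤
    | Sum.inr w => (galoisCohomology.map ((primaryInclusion V p k).restrictField (w.adicCompletion K)) 1).ker
  have h𝓕k_inf : ∀ w : InfinitePlace K, 𝓕k (Sum.inl w) = ⊤ := fun _ ↦ rfl
  have h𝓕k : ∀ w : HeightOneSpectrum (𝓞 K), w ≠ v →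
      𝓕k (Sum.inr w) = (galoisCohomology.map ((primaryInclusion V p k).restrictField (w.adicCompletion K)) 1).ker := fun _ _ ↦ rfl
  obtain ⟨x, hx𝓖, hxy⟩ := exists_levelLift_eq_of_mem_restrictedSelmerBase V p π r k e he he₁ hall 𝓕k h𝓕k_inf h𝓕k hy hNy
  refine ⟨x, ?_, hxy⟩
  refine (mem_kummerOutside_iff V (p ^ k) {Sum.inr v} x).mpr ?_
  rintro (w | w) hw
  · -- complex place: `H¹ = 0`
    have htop := LocBridge.eq_top_of_isComplex (V.torsionGaloisModule ((p ^ k : ℕ) : ℤ)) (IsTotallyComplex.isComplex w)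
      (V.kummerSelmerStructure ((p ^ k : ℕ) : ℤ) (Sum.inl w))
    change _ ∈ V.kummerSelmerStructure ((p ^ k : ℕ) : ℤ) (Sum.inl w)
    rw [htop]
    exact AddSubgroup.mem_top _
  · have hwv : w ≠ v := fun h ↦ hw (by rw [h, Finset.mem_singleton])
    have h := (SelmerStructure.mem_selmerGroup_iff _ x).mp hx𝓖 (Sum.inr w)
    rw [Function.update_of_ne (fun h' ↦ hwv (Sum.inr_injective h')), h𝓕k w hwv] at h
    exact LevelKummer.ker_map_primaryInclusion_le_kummerLocalConditionAt V p k (w.adicCompletion K) h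

end Lift

/-! ## §2. Pure algebra: a `ℤ_p`-valued functional vanishing exactly on the torsion -/

section Functional

variable {G : Type*} [AddCommGroup G] (p : ℕ) [Fact p.Prime]

/-- **An abelian group with a finite-index subgroup `U ≃+ ℤ_p` has an additive `λ : G → ℤ_p` with `λ x = 0 ↔ x` torsion**: `λ x := e([G:U]·x)`
(`[G:U]·x ∈ U`; `ℤ_p` is torsion-free, and `x` torsion-free-part zero forces `[G:U]·x = 0`). For `G = E(K_v)`, `[K_v : ℚ_p] = 1`, this is
Silverman VII.6.3's `E(K_v) ⊇ ℤ_p` of finite index. [cite: SilvermanAEC2009, Prop. VII.6.3] -/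
theorem exists_addMonoidHom_padicInt_eq_zero_iff (U : AddSubgroup G) [U.FiniteIndex] (eU : U ≃+ ℤ_[p]) :
    ∃ lam : G →+ ℤ_[p], ∀ x, lam x = 0 ↔ IsOfFinAddOrder x := by
  set m : ℕ := U.index with hm
  have hm0 : m ≠ 0 := AddSubgroup.FiniteIndex.index_ne_zero
  let ψ : G →+ U := (nsmulAddMonoidHom m : G →+ G).codRestrict U (fun x ↦ U.nsmul_index_mem x)
  have hψ : ∀ x, ((ψ x : U) : G) = m • x := fun _ ↦ rfl
  refine ⟨eU.toAddMonoidHom.comp ψ, fun x ↦ ?_⟩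
  constructor
  · intro h
    have h1 : ψ x = 0 := by
      have : eU (ψ x) = 0 := h
      exact eU.injective (by rw [this, map_zero])
    have h2 : m • x = 0 := by rw [← hψ, h1]; rfl
    exact isOfFinAddOrder_iff_nsmul_eq_zero.mpr ⟨m, Nat.pos_of_ne_zero hm0, h2⟩
  · intro hx
    obtain ⟨n, hn, hnx⟩ := isOfFinAddOrder_iff_nsmul_eq_zero.mp hx
    have h1 : n • ψ x = 0 := by
      apply Subtype.ext
      change ((n • ψ x : U) : G) = 0
      rw [AddSubmonoidClass.coe_nsmul, hψ, smul_comm, hnx, smul_zero]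
    have h2 : n • eU (ψ x) = 0 := by rw [← map_nsmul, h1, map_zero]
    have h3 : eU (ψ x) = 0 := by
      rcases (smul_eq_zero.mp h2) with h | h
      · exact absurd h hn.ne'
      · exact h
    change eU (ψ x) = 0
    exact h3

end Functional

/-! ## §3. The relaxation index at one place, from ONE point with `λ(P₁) ≠ 0` -/

section Relax

variable {K : Type} [Field K] [NumberField K] (V : WeierstrassCurve K) [V.IsElliptic] (v₀ : HeightOneSpectrum (𝓞 K))
  (p : ℕ) [Fact p.Prime]

/-- **`[H¹_{𝓛,⊤ at v₀}(K, V[p^{k+1}]) : Sel^{(p^{k+1})}] · p^{k+1−v} ≤ #V(K_{v₀})[p^{k+1}] · #(𝓞_{v₀}/p^{k+1})`** for ONE `v` (`= v_p(λ P₁)`) and every `k`,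
for any number field `K`, finite place `v₀`, additive `λ : V(K_{v₀}) → ℤ_p` and point `P₁ ∈ V(K)` with `λ(P₁) ≠ 0`: the order of `loc_{v₀} κ(P₁)`
is divisible by `p^{k+1−v}` (local Kummer sequence: `m·loc κ(P₁) = 0 ⟹ mP₁ ∈ p^{k+1} V(K_{v₀}) ⟹ p^{k+1} ∣ m·λ(P₁)`), and bsd-cn100's counting form
`relIndex_selmerGroup_kummerOutside_mul_addOrderOf_le` (Tate–Poitou reciprocity, tree theorems) applies. Twin of
`exists_relIndex_selmerGroup_kummerOutside_mul_pow_le` without the hypothesis `rank_ℤ V(K) = 1`.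
[cite: JetchevSkinnerWan2017, Prop. 3.2.1] [cite: MilneADT2006, I Thm. 4.10(b), Thm. 2.8, Lemma 3.3] [cite: SilvermanAEC2009, VIII.§2 and X.§4] -/
theorem exists_relIndex_selmerGroup_kummerOutside_mul_pow_le_of_apply_ne_zero
    (lam : (V.baseChange (v₀.adicCompletion K)).toAffine.Point →+ ℤ_[p]) (P₁ : V.toAffine.Point)
    (hu0 : lam (Affine.Point.baseChange (W' := V) K (v₀.adicCompletion K) P₁) ≠ 0) :
    ∃ v : ℕ, ∀ (k : ℕ) (m : ℕ) [NeZero m], m = p ^ (k + 1) →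
      (selmerGroup V (m : ℤ)).relIndex (kummerOutside V m {Sum.inr v₀}) ≠ 0 ∧
        (selmerGroup V (m : ℤ)).relIndex (kummerOutside V m {Sum.inr v₀}) * p ^ (k + 1 - v) ≤
          Nat.card (nsmulAddMonoidHom m : (V.baseChange (v₀.adicCompletion K)).toAffine.Point →+ _).ker *
            Nat.card (v₀.adicCompletionIntegers K ⧸ Ideal.span {(m : v₀.adicCompletionIntegers K)}) := by
  have hp : p.Prime := Fact.out
  haveI : PerfectField (v₀.adicCompletion K) := by
    haveI : CharZero (v₀.adicCompletion K) := charZero_adicCompletion v₀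
    exact PerfectField.ofCharZero
  let bc : V.toAffine.Point →+ (V.baseChange (v₀.adicCompletion K)).toAffine.Point :=
    WeierstrassCurve.Affine.Point.baseChange (W' := V) K (v₀.adicCompletion K)
  refine ⟨(lam (bc P₁)).valuation, fun k n _ hn => ?_⟩
  set v : ℕ := (lam (bc P₁)).valuation with hv
  have hnpp : IsPrimePow n := by rw [hn]; exact hp.isPrimePow.pow (Nat.succ_ne_zero k)
  have hn0 : (n : ℤ) ≠ 0 := Int.natCast_ne_zero.mpr (NeZero.ne n)
  have hdiv : ∀ P : geomPoints V, ∃ Q : geomPoints V, (n : ℤ) • Q = P :=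
    fun P => V.zsmul_geomPoints_surjective_holds hn0 P
  obtain ⟨hidx0, hmpos, hcount⟩ :=
    relIndex_selmerGroup_kummerOutside_mul_addOrderOf_le V n v₀ hnpp hdiv P₁
  refine ⟨hidx0, ?_⟩
  -- `p^{k+1-v} ∣ ord (loc κ P₁)`
  let rloc : galH1Torsion V (n : ℤ) →+
      galoisCohomology (GaloisRep.restrictField (v₀.adicCompletion K) (V.torsionGaloisModule (n : ℤ))) 1 :=
    galoisCohomology.res (V.torsionGaloisModule (n : ℤ)) (v₀.adicCompletion K) 1
  obtain ⟨m, hm⟩ : ∃ m : ℕ, m = addOrderOf (rloc (kummerMapTorsion V (n : ℤ) hdiv P₁)) := ⟨_, rfl⟩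
  have hord_dvd : p ^ (k + 1 - v) ∣ m := by
    have hres : rloc (kummerMapTorsion V (n : ℤ) hdiv (m • P₁)) = 0 := by
      rw [map_nsmul, map_nsmul, hm]
      exact addOrderOf_nsmul_eq_zero _
    obtain ⟨R, hR⟩ := exists_baseChange_eq_zsmul_of_res_kummerMapTorsion_eq_zero V hdiv
      (v₀.adicCompletion K) (m • P₁) hres
    have h1 : (m : ℤ_[p]) * lam (bc P₁) = ((n : ℤ) : ℤ_[p]) * lam R := by
      have h := congrArg lam hR
      change lam (bc (m • P₁)) = lam ((n : ℤ) • R) at h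
      simp only [map_nsmul, map_zsmul] at h
      rw [nsmul_eq_mul, zsmul_eq_mul] at h
      exact h
    have hdvd : (p : ℤ_[p]) ^ (k + 1) ∣ ((m : ℤ) : ℤ_[p]) * lam (bc P₁) := by
      refine ⟨lam R, ?_⟩
      rw [Int.cast_natCast, h1, hn]
      push_cast
      ring
    have h := pow_sub_valuation_dvd_of_pow_dvd_mul p hu0 hdvd
    have h' : (p : ℤ) ^ (k + 1 - v) ∣ (m : ℤ) := by rw [hv]; exact h
    exact_mod_cast h'
  have hm0 : m ≠ 0 := by rw [hm]; exact hmpos.ne'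
  calc (selmerGroup V (n : ℤ)).relIndex (kummerOutside V n {Sum.inr v₀}) * p ^ (k + 1 - v)
      ≤ (selmerGroup V (n : ℤ)).relIndex (kummerOutside V n {Sum.inr v₀}) * m :=
        Nat.mul_le_mul_left _ (Nat.le_of_dvd (Nat.pos_of_ne_zero hm0) hord_dvd)
    _ ≤ _ := by rw [hm]; exact hcount

/-! ## §4. A UNIFORM relaxation exponent at a place of degree one -/

/-- **Relaxing the Selmer condition at ONE place of degree one costs a UNIFORM exponent** (any number field `K`): given an additive
`λ : V(K_{v₀}) → ℤ_p`, a point `P₁ ∈ V(K)` with `λ(P₁) ≠ 0`, and `#(𝓞_{v₀}/p^{k+1}) = p^{k+1}` for every `k`, there is ONE `N ≠ 0` with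
`N • c ∈ Sel^{(p^{k+1})}(V/K)` for every `k` and every `c ∈ H¹(K, V[p^{k+1}])` that is Kummer at every place `≠ v₀`. As in bsd-cn100's
`exists_uniform_nsmul_mem_selmerGroup_of_mem_kummerOutside` (`ℚ`, rank one): §3, `#V(K_{v₀})[n] ≤ [V(K_{v₀}) : U]` for a torsion-free
finite-index `U` (`exists_finiteIndex_torsionFree_adicCompletion`, Silverman VII.6.3), `N = ([V(K_{v₀}) : U] · p^v)!`.
[cite: JetchevSkinnerWan2017, Prop. 3.2.1 (proof, arXiv:1512.06894 pp. 10–11)] [cite: MilneADT2006, I Thm. 4.10(b), Thm. 2.8, Lemma 3.3]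
[cite: SilvermanAEC2009, Prop. VII.6.3 and X.§4] -/
theorem exists_uniform_nsmul_mem_selmerGroup_of_apply_ne_zero
    (lam : (V.baseChange (v₀.adicCompletion K)).toAffine.Point →+ ℤ_[p]) (P₁ : V.toAffine.Point)
    (hu0 : lam (Affine.Point.baseChange (W' := V) K (v₀.adicCompletion K) P₁) ≠ 0)
    (hO : ∀ k : ℕ, Nat.card (v₀.adicCompletionIntegers K ⧸ Ideal.span {((p ^ (k + 1) : ℕ) : v₀.adicCompletionIntegers K)}) = p ^ (k + 1)) :
    ∃ N : ℕ, N ≠ 0 ∧ ∀ (k : ℕ) (c : galH1Torsion V ((p ^ (k + 1) : ℕ) : ℤ)),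
      c ∈ kummerOutside V (p ^ (k + 1)) {Sum.inr v₀} →
        N • c ∈ selmerGroup V ((p ^ (k + 1) : ℕ) : ℤ) := by
  have hp : p.Prime := Fact.out
  obtain ⟨v, hv⟩ := exists_relIndex_selmerGroup_kummerOutside_mul_pow_le_of_apply_ne_zero V v₀ p lam P₁ hu0
  -- a torsion-free finite-index subgroup `U ≤ V(K_{v₀})` and its index `t`
  obtain ⟨U, hU, htf, -⟩ := V.exists_finiteIndex_torsionFree_adicCompletion v₀
  haveI := hU
  obtain ⟨t, ht⟩ : ∃ t : ℕ, t = U.index := ⟨_, rfl⟩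
  have ht0 : t ≠ 0 := by rw [ht]; exact hU.index_ne_zero
  refine ⟨(t * p ^ v).factorial, Nat.factorial_ne_zero _, fun k c hc => ?_⟩
  suffices key : ∀ (n : ℕ) [NeZero n], n = p ^ (k + 1) → ∀ c : galH1Torsion V (n : ℤ),
      c ∈ kummerOutside V n {Sum.inr v₀} → (t * p ^ v).factorial • c ∈ selmerGroup V (n : ℤ) by
    haveI : NeZero (p ^ (k + 1)) := ⟨pow_ne_zero _ hp.ne_zero⟩
    exact key (p ^ (k + 1)) rfl c hc
  intro n _ hn c hc
  obtain ⟨hidx0, hcount⟩ := hv k n hn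
  obtain ⟨idx, hidx⟩ : ∃ idx : ℕ, idx = (selmerGroup V (n : ℤ)).relIndex (kummerOutside V n {Sum.inr v₀}) := ⟨_, rfl⟩
  rw [← hidx] at hidx0 hcount
  have hidxmem : idx • c ∈ selmerGroup V (n : ℤ) := by
    rw [hidx]; exact AddSubgroup.nsmul_relIndex_mem _ hc
  -- `#V(K_{v₀})[n] ≤ t` and `#(𝓞_{v₀}/n) = p^{k+1}`
  have hker : Nat.card (nsmulAddMonoidHom n : (V.baseChange (v₀.adicCompletion K)).toAffine.Point →+ _).ker ∣ t := by
    let f : (nsmulAddMonoidHom n : (V.baseChange (v₀.adicCompletion K)).toAffine.Point →+ _).ker →+ _ ⧸ U :=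
      (QuotientAddGroup.mk' U).comp (AddSubgroup.subtype _)
    have hf : Function.Injective f := by
      refine (injective_iff_map_eq_zero f).mpr fun a ha => ?_
      have hmem : (a : (V.baseChange (v₀.adicCompletion K)).toAffine.Point) ∈ U := (QuotientAddGroup.eq_zero_iff _).mp ha
      have hna : n • (a : (V.baseChange (v₀.adicCompletion K)).toAffine.Point) = 0 := a.2
      exact Subtype.ext (htf n (NeZero.ne n) _ hmem hna)
    rw [ht]
    exact AddSubgroup.card_dvd_of_injective f hf
  have hquot : Nat.card (v₀.adicCompletionIntegers K ⧸ Ideal.span {(n : v₀.adicCompletionIntegers K)}) = p ^ (k + 1) := by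
    rw [hn]; exact hO k
  have hpow : p ^ (k + 1) ≤ p ^ v * p ^ (k + 1 - v) := by
    rw [← pow_add]
    exact Nat.pow_le_pow_right hp.pos (by omega)
  have hidxle : idx ≤ t * p ^ v := by
    have hpos : 0 < p ^ (k + 1 - v) := pow_pos hp.pos _
    refine Nat.le_of_mul_le_mul_right ?_ hpos
    calc idx * p ^ (k + 1 - v)
        ≤ Nat.card (nsmulAddMonoidHom n : (V.baseChange (v₀.adicCompletion K)).toAffine.Point →+ _).ker *
          Nat.card (v₀.adicCompletionIntegers K ⧸ Ideal.span {(n : v₀.adicCompletionIntegers K)}) := hcount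
      _ ≤ t * p ^ (k + 1) := by
          rw [hquot]; exact Nat.mul_le_mul_right _ (Nat.le_of_dvd (Nat.pos_of_ne_zero ht0) hker)
      _ ≤ t * (p ^ v * p ^ (k + 1 - v)) := Nat.mul_le_mul_left _ hpow
      _ = t * p ^ v * p ^ (k + 1 - v) := by ring
  obtain ⟨q, hq⟩ := Nat.dvd_factorial (Nat.pos_of_ne_zero hidx0) hidxle
  rw [hq, mul_comm, mul_nsmul']
  exact AddSubgroup.nsmul_mem _ hidxmem q

end Relax

end Summit.BirchSwinnertonDyer.BirchSwinnertonDyer.Theorems.PrintCf2.RelaxationLift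

end
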